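import Summits.FinalStateConjecture.FinalStateConjecture.Theorems.PhotonSphereChannelsChannelsResolveTameDevelopmentsRMorawetzIdentity

/-!
# Crux `WindowedShellChannels` (stmt-FinalStateConjecture-14085), line `Sketch`, stub `stub_coneInflux` —
# part 1: the transport law of the incoming characteristic energy on exterior trapezoids

Helper file for the registered stub `stub_coneInflux` (cone-edge influx law `K(t₁) + B(t₁) ≤ IN(t₁)`) of
line `Sketch`, in the Fréchet-partial bookkeeping of the `…Theorems.WaveEnergy` files (`u : ℝ × ℝ → ℝ` a `C²`
solution of `u_tt − u_xx + Vu = 0`, `z = (t, x)`, `u_t = ∂u(z)(1,0)`, `u_x = ∂u(z)(0,1)`, `V` of class `C¹`):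

* `divergence_identity_affine` — `WaveEnergy.energy_identity_affine` with a bulk: for differentiable
  `Pd, Qd` with continuous `D = ∂ₜPd − ∂ₓQd` and affinely moving ends `α, β`,
  `∫_{α t₂}^{β t₂} Pd(t₂,·) − ∫_{α t₁}^{β t₁} Pd(t₁,·) − ∫_{t₁}^{t₂}∫_{α t}^{β t} D = ∫_{t₁}^{t₂} [(Qd + β′Pd)(·,β) − (Qd + α′Pd)(·,α)]`
  (Green's formula on the pulled-back box);
* `eps_transport` — the incoming characteristic energy density `ε = (u_t + u_x)² + Vu²` and its flux
  `j = (u_t + u_x)² − Vu²` satisfy `∂ₜε − ∂ₓj = V′u²` (`ε = e + 2P`, `j = m + 2Q` in terms of the energy,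
  momentum and `f ≡ 1` multiplier densities of `WaveEnergy.fderiv_energyDensity_eq` /
  `WaveEnergy.fderiv_multiplierP_sub`);
* `setIntegral_trapezoid`, `trapezoid_identity` (= registered sub-goal `stub_coneInflux_trapezoid`) — the
  integrated transport law on the truncated right exterior trapezoid `{t₁ ≤ t ≤ T, xp + (t − t₁) ≤ x ≤ X}`
  of the cone with apex `(t₁, xp)`:
  `∫_{xp+(T−t₁)}^{X} ε(T,·) − ∫_{xp}^{X} ε(t₁,·) − ∬ V′u² = ∫_{t₁}^{T} j(·,X) − 2∫_{t₁}^{T} (u_t + u_x)²(t, xp + (t − t₁)) dt`.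

Parts 2 (`…StubConeInfluxRight`: the right influx law, `X → ∞`, `T → ∞`) and 3 (`…StubConeInflux`: the
curried stub, left side by reflection) follow.  Standard material [folklore].
-/

noncomputable section

set_option linter.dupNamespace false

namespace Summit.FinalStateConjecture.FinalStateConjecture.Theorems.WindowedShellChannelsSketch

open Filter Set MeasureTheory
open scoped ENNReal Topology

namespace ConeInflux

/-! ### A divergence identity on quadrilaterals with affinely moving ends -/

/-- **Divergence identity with affinely moving ends.** For differentiable `Pd, Qd : ℝ × ℝ → ℝ` with
continuous "divergence" `D = ∂ₜPd − ∂ₓQd` (hypothesis `hdiv`) and `α(t) = a₀ + a₁t`, `β(t) = b₀ + b₁t`: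
`∫_{α t₂}^{β t₂} Pd(t₂,·) − ∫_{α t₁}^{β t₁} Pd(t₁,·) − ∫_{t₁}^{t₂}∫_{α t}^{β t} D(t,·) dt
  = ∫_{t₁}^{t₂} [(Qd + b₁Pd)(t, β t) − (Qd + a₁Pd)(t, α t)] dt`
(oriented interval integrals, no ordering hypotheses) — `WaveEnergy.energy_identity_affine` is the case
`D = 0`.  Proof: Green's formula on the box `[t₁,t₂] × [0,1]` (`integral2_divergence_prod_of_hasFDerivAt`)
for the pulled-back pair `F = L·Pd(t,X)`, `G = −(Qd(t,X) + ∂ₜX·Pd(t,X))`, `X = α + Lθ`, `L = β − α`,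
whose divergence is `L·D(t,X)`, and `∫₀¹ L·D(t, α + Lθ) dθ = ∫_{α}^{β} D(t,·)`. -/
theorem divergence_identity_affine {Pd Qd D : ℝ × ℝ → ℝ} (hPd : Differentiable ℝ Pd)
    (hQd : Differentiable ℝ Qd) (hD : Continuous D)
    (hdiv : ∀ z, fderiv ℝ Pd z (1, 0) - fderiv ℝ Qd z (0, 1) = D z) (a₀ a₁ b₀ b₁ t₁ t₂ : ℝ) :
    (∫ x in (a₀ + a₁ * t₂)..(b₀ + b₁ * t₂), Pd (t₂, x))
        - (∫ x in (a₀ + a₁ * t₁)..(b₀ + b₁ * t₁), Pd (t₁, x))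
        - (∫ t in t₁..t₂, ∫ x in (a₀ + a₁ * t)..(b₀ + b₁ * t), D (t, x))
      = ∫ t in t₁..t₂, ((Qd (t, b₀ + b₁ * t) + b₁ * Pd (t, b₀ + b₁ * t))
          - (Qd (t, a₀ + a₁ * t) + a₁ * Pd (t, a₀ + a₁ * t))) := by
  have hPc := hPd.continuous
  have hQc := hQd.continuous
  -- the pulled-back pair on the box `[t₁, t₂] × [0, 1]`
  set F : ℝ × ℝ → ℝ := fun p =>
    (b₀ + b₁ * p.1 - (a₀ + a₁ * p.1)) * Pd (p.1, (b₀ + b₁ * p.1 - (a₀ + a₁ * p.1)) * p.2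
      + (a₀ + a₁ * p.1)) with hF
  set G : ℝ × ℝ → ℝ := fun p =>
    -(Qd (p.1, (b₀ + b₁ * p.1 - (a₀ + a₁ * p.1)) * p.2 + (a₀ + a₁ * p.1))
      + (a₁ + (b₁ - a₁) * p.2) * Pd (p.1, (b₀ + b₁ * p.1 - (a₀ + a₁ * p.1)) * p.2
        + (a₀ + a₁ * p.1))) with hG
  have hFd : Differentiable ℝ F := by
    simp only [hF]
    fun_prop
  have hGd : Differentiable ℝ G := by
    simp only [hG]
    fun_prop
  -- the divergence of `(F, G)` is `L(t) · D(t, X(t, θ))`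
  have hdivFG : ∀ t θ : ℝ, fderiv ℝ F (t, θ) (1, 0) + fderiv ℝ G (t, θ) (0, 1)
      = (b₀ + b₁ * t - (a₀ + a₁ * t))
        * D (t, (b₀ + b₁ * t - (a₀ + a₁ * t)) * θ + (a₀ + a₁ * t)) := by
    intro t θ
    have haff : ∀ (p q s : ℝ), HasDerivAt (fun τ : ℝ => p + q * τ) q s := fun p q s => by
      simpa using ((hasDerivAt_id s).const_mul q).const_add p
    have hL : HasDerivAt (fun τ : ℝ => b₀ + b₁ * τ - (a₀ + a₁ * τ)) (b₁ - a₁) t :=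
      (haff b₀ b₁ t).fun_sub (haff a₀ a₁ t)
    have hX : HasDerivAt (fun τ : ℝ => (b₀ + b₁ * τ - (a₀ + a₁ * τ)) * θ + (a₀ + a₁ * τ))
        ((b₁ - a₁) * θ + a₁) t :=
      (hL.mul_const θ).fun_add (haff a₀ a₁ t)
    have hγ : HasDerivAt (fun τ : ℝ => (τ, (b₀ + b₁ * τ - (a₀ + a₁ * τ)) * θ + (a₀ + a₁ * τ)))
        ((1 : ℝ), (b₁ - a₁) * θ + a₁) t := (hasDerivAt_id' t).prodMk hX
    have hY : HasDerivAt (fun θ' : ℝ => (b₀ + b₁ * t - (a₀ + a₁ * t)) * θ' + (a₀ + a₁ * t))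
        (b₀ + b₁ * t - (a₀ + a₁ * t)) θ := by
      simpa using ((hasDerivAt_id θ).const_mul (b₀ + b₁ * t - (a₀ + a₁ * t))).add_const
        (a₀ + a₁ * t)
    have hδ : HasDerivAt (fun θ' : ℝ => (t, (b₀ + b₁ * t - (a₀ + a₁ * t)) * θ' + (a₀ + a₁ * t)))
        ((0 : ℝ), (b₀ + b₁ * t - (a₀ + a₁ * t))) θ := (hasDerivAt_const θ t).prodMk hY
    have hcoef : HasDerivAt (fun θ' : ℝ => a₁ + (b₁ - a₁) * θ') (b₁ - a₁) θ :=
      haff a₁ (b₁ - a₁) θ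
    set Xv : ℝ := (b₀ + b₁ * t - (a₀ + a₁ * t)) * θ + (a₀ + a₁ * t) with hXv
    have hFs : HasDerivAt (fun τ => F (τ, θ))
        ((b₁ - a₁) * Pd (t, Xv) + (b₀ + b₁ * t - (a₀ + a₁ * t))
          * fderiv ℝ Pd (t, Xv) ((1 : ℝ), (b₁ - a₁) * θ + a₁)) t := by
      have h := hL.fun_mul (WaveEnergy.hasDerivAt_comp_curve hPd hγ)
      exact h
    have hGs : HasDerivAt (fun θ' => G (t, θ'))
        (-(fderiv ℝ Qd (t, Xv) ((0 : ℝ), (b₀ + b₁ * t - (a₀ + a₁ * t)))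
          + ((b₁ - a₁) * Pd (t, Xv)
            + (a₁ + (b₁ - a₁) * θ)
              * fderiv ℝ Pd (t, Xv) ((0 : ℝ), (b₀ + b₁ * t - (a₀ + a₁ * t)))))) θ := by
      have h := ((WaveEnergy.hasDerivAt_comp_curve hQd hδ).fun_add
        (hcoef.fun_mul (WaveEnergy.hasDerivAt_comp_curve hPd hδ))).fun_neg
      exact h
    have h1 := (WaveEnergy.hasDerivAt_slice_fst hFd t θ).unique hFs
    have h2 := (WaveEnergy.hasDerivAt_slice_snd hGd t θ).unique hGs
    rw [h1, h2, WaveEnergy.clm_apply_one_snd (fderiv ℝ Pd (t, Xv)) ((b₁ - a₁) * θ + a₁),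
      WaveEnergy.clm_apply_zero_snd (fderiv ℝ Qd (t, Xv)) (b₀ + b₁ * t - (a₀ + a₁ * t)),
      WaveEnergy.clm_apply_zero_snd (fderiv ℝ Pd (t, Xv)) (b₀ + b₁ * t - (a₀ + a₁ * t))]
    linear_combination (b₀ + b₁ * t - (a₀ + a₁ * t)) * hdiv (t, Xv)
  -- Green's formula on the box
  have hdivc : Continuous fun z : ℝ × ℝ => (b₀ + b₁ * z.1 - (a₀ + a₁ * z.1))
      * D (z.1, (b₀ + b₁ * z.1 - (a₀ + a₁ * z.1)) * z.2 + (a₀ + a₁ * z.1)) := by fun_prop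
  have hdivfun : (fun z : ℝ × ℝ => fderiv ℝ F z (1, 0) + fderiv ℝ G z (0, 1)) = fun z =>
      (b₀ + b₁ * z.1 - (a₀ + a₁ * z.1))
        * D (z.1, (b₀ + b₁ * z.1 - (a₀ + a₁ * z.1)) * z.2 + (a₀ + a₁ * z.1)) :=
    funext fun z => hdivFG z.1 z.2
  have key := integral2_divergence_prod_of_hasFDerivAt F G (fderiv ℝ F) (fderiv ℝ G) t₁ 0 t₂ 1
    hFd.continuous.continuousOn hGd.continuous.continuousOn
    (fun z _ => (hFd z).hasFDerivAt) (fun z _ => (hGd z).hasFDerivAt)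
    (by
      rw [hdivfun]
      exact hdivc.continuousOn.integrableOn_compact (isCompact_uIcc.prod isCompact_uIcc))
  have hlhs : (∫ t in t₁..t₂, ∫ θ in (0 : ℝ)..1,
      fderiv ℝ F (t, θ) (1, 0) + fderiv ℝ G (t, θ) (0, 1))
      = ∫ t in t₁..t₂, ∫ x in (a₀ + a₁ * t)..(b₀ + b₁ * t), D (t, x) := by
    refine intervalIntegral.integral_congr fun t _ => ?_
    simp only [hdivFG]
    rw [intervalIntegral.integral_const_mul,
      intervalIntegral.mul_integral_comp_mul_add (f := fun x => D (t, x))]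
    congr 1 <;> ring
  rw [hlhs] at key
  -- evaluate the four boundary terms
  have hG1 : ∀ t, G (t, 1) = -(Qd (t, b₀ + b₁ * t) + b₁ * Pd (t, b₀ + b₁ * t)) := by
    intro t
    have e1 : (b₀ + b₁ * t - (a₀ + a₁ * t)) * 1 + (a₀ + a₁ * t) = b₀ + b₁ * t := by ring
    have e2 : a₁ + (b₁ - a₁) * 1 = b₁ := by ring
    simp only [hG, e1, e2]
  have hG0 : ∀ t, G (t, 0) = -(Qd (t, a₀ + a₁ * t) + a₁ * Pd (t, a₀ + a₁ * t)) := by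
    intro t
    have e1 : (b₀ + b₁ * t - (a₀ + a₁ * t)) * 0 + (a₀ + a₁ * t) = a₀ + a₁ * t := by ring
    have e2 : a₁ + (b₁ - a₁) * 0 = a₁ := by ring
    simp only [hG, e1, e2]
  have hFint : ∀ t, (∫ θ in (0 : ℝ)..1, F (t, θ))
      = ∫ x in (a₀ + a₁ * t)..(b₀ + b₁ * t), Pd (t, x) := by
    intro t
    simp only [hF]
    rw [intervalIntegral.integral_const_mul,
      intervalIntegral.mul_integral_comp_mul_add (f := fun x => Pd (t, x))]
    congr 1 <;> ring
  rw [hFint, hFint] at key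
  simp_rw [hG1, hG0] at key
  have hi1 : IntervalIntegrable (fun t => -(Qd (t, b₀ + b₁ * t) + b₁ * Pd (t, b₀ + b₁ * t)))
      volume t₁ t₂ := by
    apply Continuous.intervalIntegrable
    fun_prop
  have hi0 : IntervalIntegrable (fun t => -(Qd (t, a₀ + a₁ * t) + a₁ * Pd (t, a₀ + a₁ * t)))
      volume t₁ t₂ := by
    apply Continuous.intervalIntegrable
    fun_prop
  have hsub := intervalIntegral.integral_sub hi0 hi1
  have hcongr : (∫ t in t₁..t₂, ((Qd (t, b₀ + b₁ * t) + b₁ * Pd (t, b₀ + b₁ * t))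
      - (Qd (t, a₀ + a₁ * t) + a₁ * Pd (t, a₀ + a₁ * t))))
      = ∫ t in t₁..t₂, (-(Qd (t, a₀ + a₁ * t) + a₁ * Pd (t, a₀ + a₁ * t))
        - -(Qd (t, b₀ + b₁ * t) + b₁ * Pd (t, b₀ + b₁ * t))) := by
    congr 1
    funext t
    ring
  rw [hcongr, hsub]
  linarith

/-! ### Fubini on the truncated right exterior trapezoid -/

/-- The truncated right exterior trapezoid `{t₁ < t ≤ T, xp + (t − t₁) < x ≤ X}` of the cone with apex
`(t₁, xp)`: for a continuous integrand its set integral is the iterated interval integral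
`∫_{t₁}^{T} ∫_{xp+(t−t₁)}^{X} g(t,·) dt` (`t₁ ≤ T`, `xp + (T − t₁) ≤ X`). -/
theorem setIntegral_trapezoid {g : ℝ × ℝ → ℝ} (hg : Continuous g) {t₁ T xp X : ℝ} (hT : t₁ ≤ T)
    (hX : xp + (T - t₁) ≤ X) :
    ∫ z in {z : ℝ × ℝ | z.1 ∈ Ioc t₁ T ∧ z.2 ∈ Ioc (xp + (z.1 - t₁)) X}, g z
      = ∫ t in t₁..T, ∫ x in (xp + (t - t₁))..X, g (t, x) := by
  set R : Set (ℝ × ℝ) := {z : ℝ × ℝ | z.1 ∈ Ioc t₁ T ∧ z.2 ∈ Ioc (xp + (z.1 - t₁)) X} with hR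
  have hRm : MeasurableSet R := by
    have h1 : MeasurableSet {z : ℝ × ℝ | t₁ < z.1} := measurableSet_lt measurable_const measurable_fst
    have h2 : MeasurableSet {z : ℝ × ℝ | z.1 ≤ T} := measurableSet_le measurable_fst measurable_const
    have h3 : MeasurableSet {z : ℝ × ℝ | xp + (z.1 - t₁) < z.2} :=
      measurableSet_lt (by fun_prop) measurable_snd
    have h4 : MeasurableSet {z : ℝ × ℝ | z.2 ≤ X} := measurableSet_le measurable_snd measurable_const
    convert ((h1.inter h2).inter h3).inter h4 using 1
    ext z
    simp only [hR, mem_setOf_eq, mem_Ioc, mem_inter_iff]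
    tauto
  have hRsub : R ⊆ Icc t₁ T ×ˢ Icc xp X := by
    rintro ⟨t, x⟩ ⟨⟨ht1, ht2⟩, hx1, hx2⟩
    simp only at hx1
    exact ⟨⟨ht1.le, ht2⟩, by linarith, hx2⟩
  have hint : IntegrableOn g R :=
    (hg.continuousOn.integrableOn_compact (isCompact_Icc.prod isCompact_Icc)).mono_set hRsub
  have hslice : ∀ t, (∫ x, R.indicator g (t, x))
      = (Ioc t₁ T).indicator (fun t => ∫ x in Ioc (xp + (t - t₁)) X, g (t, x)) t := by
    intro t
    by_cases ht : t ∈ Ioc t₁ T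
    · rw [indicator_of_mem ht, ← integral_indicator measurableSet_Ioc]
      congr 1
      funext x
      simp only [Set.indicator_apply, hR, mem_setOf_eq, ht, true_and]
    · have h0 : (fun x => R.indicator g (t, x)) = fun _ => 0 := funext fun x => by
        simp only [Set.indicator_apply, hR, mem_setOf_eq, ht, false_and, if_false]
      rw [h0, integral_zero]
      simp only [Set.indicator_apply, ht, if_false]
  rw [← integral_indicator hRm, Measure.volume_eq_prod, integral_prod _ ?_]
  swap
  · exact (integrable_indicator_iff hRm).2 (by rw [← Measure.volume_eq_prod]; exact hint)
  simp_rw [hslice]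
  rw [integral_indicator measurableSet_Ioc, ← intervalIntegral.integral_of_le hT]
  refine intervalIntegral.integral_congr fun t ht => ?_
  rw [uIcc_of_le hT] at ht
  have hle : xp + (t - t₁) ≤ X := by linarith [ht.2]
  exact (intervalIntegral.integral_of_le hle).symm

/-! ### The incoming characteristic energy density and its transport law -/

section Transport

variable {u : ℝ × ℝ → ℝ} {V V' : ℝ → ℝ}

/-- The incoming characteristic energy density `ε = (u_t + u_x)² + Vu²` and its flux `j = (u_t + u_x)² − Vu²`
(hypotheses `hε`, `hj`) of a `C²` solution of `u_tt − u_xx + Vu = 0` (`V` of class `C¹`) are differentiable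
and satisfy the **transport law** `∂ₜε − ∂ₓj = V′u²`: indeed `ε = e + 2P`, `j = m + 2Q` for the energy and
momentum densities `e, m` (`WaveEnergy.fderiv_energyDensity_eq`: `∂ₜe = ∂ₓm`) and the multiplier current
`P = u_t u_x` and flux `Q = ½(u_t² + u_x²) − ½Vu²` of `WaveEnergy.fderiv_multiplierP_sub` with
`f ≡ 1, β ≡ 0, φ = V/2` (`∂ₜP − ∂ₓQ = ½V′u²`). -/
theorem eps_transport (hu : ContDiff ℝ 2 u) (hV : ∀ x, HasDerivAt V (V' x) x)
    (hsol : ∀ z : ℝ × ℝ, fderiv ℝ (fderiv ℝ u) z (1, 0) (1, 0)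
      - fderiv ℝ (fderiv ℝ u) z (0, 1) (0, 1) + V z.2 * u z = 0)
    {ε j : ℝ × ℝ → ℝ}
    (hε : ∀ z, ε z = (fderiv ℝ u z (1, 0) + fderiv ℝ u z (0, 1)) ^ 2 + V z.2 * u z ^ 2)
    (hj : ∀ z, j z = (fderiv ℝ u z (1, 0) + fderiv ℝ u z (0, 1)) ^ 2 - V z.2 * u z ^ 2) :
    Differentiable ℝ ε ∧ Differentiable ℝ j ∧
      ∀ z, fderiv ℝ ε z (1, 0) - fderiv ℝ j z (0, 1) = V' z.2 * u z ^ 2 := by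
  have hVd : Differentiable ℝ V := fun x => (hV x).differentiableAt
  -- the four densities of the `WaveEnergy` files
  obtain ⟨e, he⟩ : ∃ e : ℝ × ℝ → ℝ, ∀ z, e z
      = (fderiv ℝ u z (1, 0)) ^ 2 + (fderiv ℝ u z (0, 1)) ^ 2 + V z.2 * u z ^ 2 := ⟨_, fun _ => rfl⟩
  obtain ⟨m, hm⟩ : ∃ m : ℝ × ℝ → ℝ, ∀ z, m z
      = 2 * fderiv ℝ u z (1, 0) * fderiv ℝ u z (0, 1) := ⟨_, fun _ => rfl⟩
  obtain ⟨P, hP⟩ : ∃ P : ℝ × ℝ → ℝ, ∀ z, P z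
      = fderiv ℝ u z (1, 0) * fderiv ℝ u z (0, 1) := ⟨_, fun _ => rfl⟩
  obtain ⟨Q, hQ⟩ : ∃ Q : ℝ × ℝ → ℝ, ∀ z, Q z
      = 1 / 2 * (fderiv ℝ u z (1, 0) ^ 2 + fderiv ℝ u z (0, 1) ^ 2) - V z.2 / 2 * u z ^ 2 :=
    ⟨_, fun _ => rfl⟩
  obtain ⟨Bk, hB⟩ : ∃ Bk : ℝ × ℝ → ℝ, ∀ z, Bk z = -(V' z.2 / 2 * u z ^ 2) := ⟨_, fun _ => rfl⟩
  have hf : ∀ x : ℝ, HasDerivAt (fun _ : ℝ => (1 : ℝ)) 0 x := fun x => hasDerivAt_const x 1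
  have hβ : ∀ x : ℝ, HasDerivAt (fun _ : ℝ => (0 : ℝ)) 0 x := fun x => hasDerivAt_const x 0
  have hφ : ∀ x : ℝ, HasDerivAt (fun y => V y / 2) (V' x / 2) x := fun x => (hV x).div_const 2
  have hPd : Differentiable ℝ P :=
    WaveEnergy.differentiable_multiplierP (f := fun _ => 1) (f' := fun _ => 0) (β := fun _ => 0)
      (β' := fun _ => 0) hu hf hβ (fun z => by simp only [hP]; ring)
  have hQd : Differentiable ℝ Q :=
    WaveEnergy.differentiable_multiplierQ (f := fun _ => 1) (f' := fun _ => 0) (β := fun _ => 0)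
      (β' := fun _ => 0) (φ := fun y => V y / 2) (φ' := fun y => V' y / 2) hu hf hβ hφ
      (fun z => by simp only [hQ]; ring)
  have hmult : ∀ z, fderiv ℝ P z (1, 0) - fderiv ℝ Q z (0, 1) + Bk z = 0 :=
    WaveEnergy.fderiv_multiplierP_sub (f := fun _ => 1) (f' := fun _ => 0) (β := fun _ => 0)
      (β' := fun _ => 0) (φ := fun y => V y / 2) (φ' := fun y => V' y / 2) hu hsol hf hβ hφ
      (fun z => by simp only [hP]; ring) (fun z => by simp only [hQ]; ring)
      (fun z => by simp only [hB]; ring)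
  have hed := WaveEnergy.differentiable_energyDensity hu hVd he
  have hmd := WaveEnergy.differentiable_momentumDensity hu hm
  have hcons := WaveEnergy.fderiv_energyDensity_eq hu hVd hsol he hm
  have hεe : ∀ z, ε z = e z + 2 * P z := fun z => by rw [hε, he, hP]; ring
  have hjm : ∀ z, j z = m z + 2 * Q z := fun z => by rw [hj, hm, hQ]; ring
  have hεF : ∀ z, HasFDerivAt ε (fderiv ℝ e z + (2 : ℝ) • fderiv ℝ P z) z := fun z =>
    ((hed z).hasFDerivAt.add ((hPd z).hasFDerivAt.const_mul (2 : ℝ))).congr_of_eventuallyEq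
      (Eventually.of_forall fun y => hεe y)
  have hjF : ∀ z, HasFDerivAt j (fderiv ℝ m z + (2 : ℝ) • fderiv ℝ Q z) z := fun z =>
    ((hmd z).hasFDerivAt.add ((hQd z).hasFDerivAt.const_mul (2 : ℝ))).congr_of_eventuallyEq
      (Eventually.of_forall fun y => hjm y)
  refine ⟨fun z => (hεF z).differentiableAt, fun z => (hjF z).differentiableAt, fun z => ?_⟩
  rw [(hεF z).fderiv, (hjF z).fderiv]
  simp only [add_apply, FunLike.coe_smul, Pi.smul_apply,
    smul_eq_mul]
  have h1 := hcons z
  have h2 := hmult z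
  rw [hB] at h2
  linear_combination h1 + 2 * h2

/-- **The `ε`-transport identity on the truncated right exterior trapezoid** `{t₁ ≤ t ≤ T,
xp + (t − t₁) ≤ x ≤ X}` of the cone with apex `(t₁, xp)` (`t₁ ≤ T`, `xp + (T − t₁) ≤ X`):
`∫_{xp+(T−t₁)}^{X} ε(T,·) − ∫_{xp}^{X} ε(t₁,·) − ∬ V′u² = ∫_{t₁}^{T} j(·, X) − 2∫_{t₁}^{T} (u_t + u_x)²(t, xp + (t − t₁)) dt`
(`divergence_identity_affine` with the moving end `α(t) = xp + (t − t₁)` and the fixed end `X`; on the null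
edge `j + ε = 2(u_t + u_x)²`). -/
theorem trapezoid_identity (hu : ContDiff ℝ 2 u) (hV : ∀ x, HasDerivAt V (V' x) x)
    (hV'c : Continuous V')
    (hsol : ∀ z : ℝ × ℝ, fderiv ℝ (fderiv ℝ u) z (1, 0) (1, 0)
      - fderiv ℝ (fderiv ℝ u) z (0, 1) (0, 1) + V z.2 * u z = 0)
    {ε j : ℝ × ℝ → ℝ}
    (hε : ∀ z, ε z = (fderiv ℝ u z (1, 0) + fderiv ℝ u z (0, 1)) ^ 2 + V z.2 * u z ^ 2)
    (hj : ∀ z, j z = (fderiv ℝ u z (1, 0) + fderiv ℝ u z (0, 1)) ^ 2 - V z.2 * u z ^ 2)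
    {t₁ T xp X : ℝ} (hT : t₁ ≤ T) (hX : xp + (T - t₁) ≤ X) :
    (∫ x in (xp + (T - t₁))..X, ε (T, x)) - (∫ x in xp..X, ε (t₁, x))
        - (∫ z in {z : ℝ × ℝ | z.1 ∈ Ioc t₁ T ∧ z.2 ∈ Ioc (xp + (z.1 - t₁)) X}, V' z.2 * u z ^ 2)
      = (∫ t in t₁..T, j (t, X))
        - ∫ t in t₁..T, 2 * (fderiv ℝ u (t, xp + (t - t₁)) (1, 0)
          + fderiv ℝ u (t, xp + (t - t₁)) (0, 1)) ^ 2 := by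
  obtain ⟨hεd, hjd, hdiv⟩ := eps_transport hu hV hsol hε hj
  have hεc := hεd.continuous
  have hjc := hjd.continuous
  have hDc : Continuous fun z : ℝ × ℝ => V' z.2 * u z ^ 2 :=
    (hV'c.comp continuous_snd).mul ((WaveEnergy.differentiable_of_contDiff_two hu).continuous.pow 2)
  have key := divergence_identity_affine hεd hjd hDc hdiv (xp - t₁) 1 X 0 t₁ T
  have hα : ∀ t, xp - t₁ + t = xp + (t - t₁) := fun t => by ring
  simp only [zero_mul, add_zero, one_mul] at key
  simp only [hα, sub_self, add_zero] at key
  have hF := setIntegral_trapezoid hDc hT hX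
  simp only at hF
  have hi1 : IntervalIntegrable (fun t => j (t, X)) volume t₁ T := by
    apply Continuous.intervalIntegrable
    fun_prop
  have hi2 : IntervalIntegrable (fun t => j (t, xp + (t - t₁)) + ε (t, xp + (t - t₁))) volume t₁ T := by
    apply Continuous.intervalIntegrable
    fun_prop
  rw [intervalIntegral.integral_sub hi1 hi2] at key
  rw [hF, key]
  congr 1
  refine intervalIntegral.integral_congr fun t _ => ?_
  simp only [hj, hε]
  ring

end Transport


/-- **Registered sub-goal `stub_coneInflux_trapezoid` of stub `stub_coneInflux`** (crux
stmt-FinalStateConjecture-14085, line `Sketch`): the integrated transport law on the truncated right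
exterior trapezoid, in closed form (`trapezoid_identity`). [folklore] -/
theorem stub_coneInflux_trapezoid :
    ∀ (u : ℝ × ℝ → ℝ) (V V' : ℝ → ℝ), ContDiff ℝ 2 u → (∀ x, HasDerivAt V (V' x) x) → Continuous V' →
      (∀ z : ℝ × ℝ, fderiv ℝ (fderiv ℝ u) z (1, 0) (1, 0) - fderiv ℝ (fderiv ℝ u) z (0, 1) (0, 1)
      + V z.2 * u z = 0) →
      ∀ (ε j : ℝ × ℝ → ℝ),
      (∀ z, ε z = (fderiv ℝ u z (1, 0) + fderiv ℝ u z (0, 1)) ^ 2 + V z.2 * u z ^ 2) →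
      (∀ z, j z = (fderiv ℝ u z (1, 0) + fderiv ℝ u z (0, 1)) ^ 2 - V z.2 * u z ^ 2) →
      ∀ (t₁ T xp X : ℝ), t₁ ≤ T → xp + (T - t₁) ≤ X →
      (∫ x in (xp + (T - t₁))..X, ε (T, x)) - (∫ x in xp..X, ε (t₁, x))
      - (∫ z in {z : ℝ × ℝ | z.1 ∈ Set.Ioc t₁ T ∧ z.2 ∈ Set.Ioc (xp + (z.1 - t₁)) X}, V' z.2 * u z ^ 2)
      = (∫ t in t₁..T, j (t, X))
      - ∫ t in t₁..T, 2 * (fderiv ℝ u (t, xp + (t - t₁)) (1, 0) + fderiv ℝ u (t, xp + (t - t₁)) (0, 1)) ^ 2 :=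
  fun _ _ _ hu hV hV'c hsol _ _ hε hj _ _ _ _ hT hX => trapezoid_identity hu hV hV'c hsol hε hj hT hX

end ConeInflux

end Summit.FinalStateConjecture.FinalStateConjecture.Theorems.WindowedShellChannelsSketch

end
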